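import Literature.Geometry.Kaehler.ComplexTorusWeylOperatorMiddleCohomology
import Literature.Algebra.Lie.LefschetzModuleWeylOperatorIsotypicBlocks
import HarnessLib

/-!
# The Weyl element on the `V(k)`-isotypic pieces `⊕ᵢ Lⁱ P^{g−k}(η)` of the cohomology of a complex torus:
# `tr(w | ⊕ᵢ Lⁱ P^{g−2m}) = (−1)^m dim P^{g−2m}(η)`, `tr(w | ⊕ᵢ Lⁱ P^{g−2m−1}) = 0`, the multiplicities piece by piece, and
# `Σ_{m ≤ g/2} (−1)^m dim P^{g−2m}(η) = 2^g`

[topic Geometry/Kaehler]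

Layer `Literature/Geometry/Kaehler` (Layer A: invariant forms `H•(X; ℂ) = GForm E ℂ` of the complex torus `X = E/Λ`, `g = dim_ℂ E`), namespace
`Literature.Geometry.Kaehler.ComplexTorus`; lane `lit-hodgefound` (Track 2 foundations library), prover seat `lit-hodgefound-p09` (generation 56,
row g56-#10: the Kähler carrier of row g56-#7 `Algebra/Lie/LefschetzModuleWeylOperatorIsotypicBlocks`).  THEOREMS ONLY (no definition, no named fact,
no instance, no notation; D-0026 net debt `0`).

For a non-degenerate real `2`-form `η` on `E` the triple `(H•(X; ℂ), h, L_η)` (`h = k − g` on `Hᵏ`, tree `countingG`, `lefschetzG`,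
`hasLefschetzProperty_lefschetzG`) is a Lefschetz module whose primitive subspace of `h`-degree `−k` is `P^{g−k}(η)` placed in degree `g − k`
(tree `primitiveSpace_countingG_eq_map`, `finrank_primitiveSpace_countingG`), so its `V(k)`-ISOTYPIC PIECE `M[k] = ⊕ᵢ Lⁱ P_{−k}` is the sum of
Lange's Lefschetz summands `Lⁱ P^{g−k} ⊂ H^{g−k+2i}`, `0 ≤ i ≤ k` (§1).  Row g56-#7 computed, for any Lefschetz module, the trace and the
multiplicities of the Weyl operator `w` on `M[k]` (`tr(w | M[k]) = χ_k(w) dim P_{−k}` with Bröcker–tom Dieck's `χ_{2m}(w) = (−1)^m`,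
`χ_{2m+1}(w) = 0`); this file reads those statements on the torus, where `w` is Beauville's Fourier–Weyl element `ρ(0 −1 ; 1 0)`, and adds the
global count they imply: since `tr w = 2^g` on `H•(X; ℂ)` (tree `trace_weylOperator`), **`Σ_{m ≤ g/2} (−1)^m dim_ℂ P^{g−2m}(η) = 2^g`** — the
alternating sum of the primitive Betti numbers `dim P^g, dim P^{g−2}, …` is `2^g` (§3).

## Sources, VERBATIM

* A. Beauville, *The action of SL₂ on abelian varieties*, J. Ramanujan Math. Soc. 25 (2010) [Beauville2010SL2] (held `paper:arxiv-0805.1541`),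
  §4 Theorem (p0005: "`(0 −1 ; 1 0) · z = ℱ(z)`", "`h · z = (2p − g − s) z`") and §5 Corollary (p0006: "`CH^p_s(A) = ⊕ θ^{p−q} P^q_s`",
  "`ℱ(θ^q z/q!) = ((−θ)^r/r!) z`"); §3 Theorem ("`tr` … `= (t + t⁻¹ … )`", the character) and Proposition (ii) ("`h² = (β(u)h)³ = β(−I)`").
* H. Lange, *Abelian Varieties over the Complex Numbers* (2023) [Lange2023AbelianVarietiesComplex], §7.3.2 (3) ("`⋀ᵏ V = Pᵏ ⊕ L P^{k−2} ⊕ ⋯`",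
  `dim Pᵏ = C(2g, k) − C(2g, k − 2)`).
* Th. Bröcker, T. tom Dieck, *Representations of Compact Lie Groups* (1985) [BrockerTomDieck1985] (held, II §5 p0080: "The character `χ_n` of `V_n`
  has the value `Σ_{k=0}^{n} e^{i(n−2k)t}` at `e(t)`"; "`−E` acts as multiplication by `(−1)^n` on `V_n`").
* J.-P. Serre, *Linear Representations of Finite Groups* (1977) [Serre1977] (held), §2.1 Exercise 2.2 (p0016), §2.6 Thm. 8 and Exercise 2.8 (p0024).

## What is proved (`g = finrank ℂ E`, `hη` non-degeneracy, `w = (hasLefschetzProperty_lefschetzG hη).weylOperator isZGrading_countingG`,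
`M[k] = ⨆ᵢ (primitiveSpace (countingG E) (lefschetzG η) k).map (lefschetzG η ^ i)`)

* §1 **`iSup_map_pow_lefschetzG_primitiveSpace_eq_biSup`** (`M[k] = ⊕_{i ≤ k} single_{g−k+2i} (Lⁱ P^{g−k}(η))`, `k ≤ g`),
  `iSup_map_pow_lefschetzG_primitiveSpace_eq_bot` (`k > g`), `finrank_iSup_map_pow_lefschetzG_primitiveSpace` (`dim M[k] = (k+1) dim P^{g−k}(η)`).
* §2 **`trace_weylOperator_restrict_iSup_map_pow_lefschetzG_primitiveSpace`** (`tr(w | M[k]) = χ_k(w) dim P^{g−k}(η)`), `…_two_mul`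
  (`= (−1)^m dim P^{g−2m}(η)`), `…_two_mul_add_one` (`= 0`).
* §3 **`sum_neg_one_pow_mul_finrank_primitiveForms_eq_two_pow`** (`Σ_{m ≤ g/2} (−1)^m dim P^{g−2m}(η) = 2^g`, over `ℤ`),
  `sum_finrank_primitiveForms_even_eq_two_pow_add_sum_odd` (the same over `ℕ`: `Σ_{m even} dim P^{g−2m} = 2^g + Σ_{m odd} dim P^{g−2m}`).
* §4 multiplicities piece by piece: **`two_mul_finrank_iSup_map_pow_lefschetzG_primitiveSpace_two_mul_inf_eigenspace_weylOperator_one`** /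
  `_neg_one` (`2 dim (M[2m] ∩ ker(w ∓ 1)) = (2m + 1 ± (−1)^m) dim P^{g−2m}(η)`), `iSup_map_pow_lefschetzG_primitiveSpace_two_mul_inf_eigenspace_weylOperator_I`
  / `_neg_I` (`= 0`), `iSup_map_pow_lefschetzG_primitiveSpace_two_mul_add_one_inf_eigenspace_weylOperator_one` / `_neg_one` (`= 0`),
  **`finrank_iSup_map_pow_lefschetzG_primitiveSpace_two_mul_add_one_inf_eigenspace_weylOperator_I`** / `_neg_I`
  (`dim (M[2m+1] ∩ ker(w ∓ i)) = (m + 1) dim P^{g−2m−1}(η)`).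
* §5 (ALL PIECES) `biSup_iSup_map_pow_lefschetzG_primitiveSpace_eq_top` (`H•(X; ℂ) = ⊕_{k ≤ g} M[k]`),
  **`finrank_eigenspace_weylOperator_I_eq_sum_primitiveForms`** (`dim ker(w − i) = Σ_{k ≤ g odd} ((k+1)/2) dim P^{g−k}(η)`) and
  **`sum_odd_mul_finrank_primitiveForms_eq_pow`** (`Σ_{k ≤ g odd} ((k+1)/2) dim P^{g−k}(η) = 4^{g−1}`),
  `two_mul_finrank_eigenspace_weylOperator_one_eq_sum_primitiveForms` / `…_neg_one_…` and `sum_even_mul_finrank_primitiveForms_eq` / `…_eq'`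
  (`Σ_{k ≤ g even} (k + 1 ± (−1)^{k/2}) dim P^{g−k}(η) = 2 (4^{g−1} ± 2^{g−1})`).

## SCOPE

(a) `η` is any non-degenerate real `2`-form (no type-`(1,1)` or positivity hypothesis).  (b) Forms carrier only; no lattice / rationality
statement.  (c) HC is not touched; foundations-library row.
-/

noncomputable section

namespace Literature.Geometry.Kaehler

namespace ComplexTorus

-- `_root_.Complex`: the import closure declares a namespace `…ComplexTorus.Complex`; be explicit.
open Module Function Finset _root_.Complex
open Literature.LinearAlgebra Literature.LinearAlgebra.Alternating Literature.Algebra.Lie Literature.Analysis.Complex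

universe uE

variable {E : Type uE} [NormedAddCommGroup E] [NormedSpace ℂ E] [FiniteDimensional ℂ E] [Nontrivial E] {η : E [⋀^Fin 2]→L[ℝ] ℝ}

/-! ## §1 The `V(k)`-isotypic piece `M[k] = ⊕_{i ≤ k} Lⁱ P^{g−k}(η)` -/

/-- **`M[k] = ⊕_{i ≤ k} Lⁱ P^{g−k}(η)`** (`k ≤ g`): the `V(k)`-isotypic piece of `(H•(X; ℂ), h, L_η)` is the sum of the Lefschetz summands
`Lⁱ P^{g−k} ⊂ H^{g−k+2i}`, `0 ≤ i ≤ k`, each placed in its degree. [cite: Lange2023AbelianVarietiesComplex, §7.3.2 (3) ("⋀ᵏ V = Pᵏ ⊕ L P^{k−2} ⊕ ⋯")]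
[cite: Beauville2010SL2, §5 Corollary ("CH^p_s(A) = ⊕_{q≤p} θ^{p−q} P^q_s")] -/
theorem iSup_map_pow_lefschetzG_primitiveSpace_eq_biSup (hη : ∀ v : E, v ≠ 0 → ∃ w : E, η ![v, w] ≠ 0) {k : ℕ} (hk : k ≤ finrank ℂ E) :
    ⨆ i : ℕ, (HasLefschetzProperty.primitiveSpace (countingG E) (lefschetzG η) k).map (lefschetzG η ^ i) =
      ⨆ i ∈ range (k + 1), (lefschetzSummandForms η (2 * i + (finrank ℂ E - k)) i).map
        (LinearMap.single ℂ (fun m : ℕ ↦ E [⋀^Fin m]→L[ℝ] ℂ) (2 * i + (finrank ℂ E - k))) := by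
  refine le_antisymm (iSup_le fun i ↦ ?_) (iSup₂_le fun i hi ↦ ?_)
  · by_cases hi : i ≤ k
    · rw [map_pow_lefschetzG_primitiveSpace_eq_map_single hη hk rfl]
      exact le_iSup₂_of_le (f := fun (i : ℕ) (_ : i ∈ range (k + 1)) ↦ (lefschetzSummandForms η (2 * i + (finrank ℂ E - k)) i).map
        (LinearMap.single ℂ (fun m : ℕ ↦ E [⋀^Fin m]→L[ℝ] ℂ) (2 * i + (finrank ℂ E - k)))) i (mem_range.2 (Nat.lt_succ_of_le hi)) le_rfl
    · rw [HasLefschetzProperty.map_pow_primitiveSpace_eq_bot_of_lt (not_le.1 hi)]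
      exact bot_le
  · rw [← map_pow_lefschetzG_primitiveSpace_eq_map_single hη hk rfl]
    exact le_iSup (fun i : ℕ ↦ (HasLefschetzProperty.primitiveSpace (countingG E) (lefschetzG η) k).map (lefschetzG η ^ i)) i

omit [FiniteDimensional ℂ E] [Nontrivial E] in
/-- `M[k] = 0` for `k > g` (no primitive classes below degree `0`). [cite: Beauville2010SL2, §5 Proposition ("g + s − 2p ≥ 0")] -/
theorem iSup_map_pow_lefschetzG_primitiveSpace_eq_bot {k : ℕ} (hk : finrank ℂ E < k) :
    ⨆ i : ℕ, (HasLefschetzProperty.primitiveSpace (countingG E) (lefschetzG η) k).map (lefschetzG η ^ i) = ⊥ := by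
  rw [primitiveSpace_eq_bot_of_lt hk]
  simp only [Submodule.map_bot, iSup_bot]

/-- **`dim M[k] = (k + 1) dim P^{g−k}(η)`** (`k ≤ g`; `k + 1` summands, each `≅ P^{g−k}` by hard Lefschetz).
[cite: Lange2023AbelianVarietiesComplex, §7.3.2 (3)] [cite: LooijengaLunts1997, §1 (1.14) p. 7 ("M ≅ ⊕_k V(k) ⊗ P_{−k}")] -/
theorem finrank_iSup_map_pow_lefschetzG_primitiveSpace (hη : ∀ v : E, v ≠ 0 → ∃ w : E, η ![v, w] ≠ 0) {k : ℕ} (hk : k ≤ finrank ℂ E) :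
    finrank ℂ ↥(⨆ i : ℕ, (HasLefschetzProperty.primitiveSpace (countingG E) (lefschetzG η) k).map (lefschetzG η ^ i)) =
      (k + 1) * finrank ℂ ↥(primitiveForms η (finrank ℂ E - k)) := by
  rw [(hasLefschetzProperty_lefschetzG hη).finrank_iSup_map_pow_primitiveSpace isZGrading_countingG, finrank_primitiveSpace_countingG hη hk]

/-! ## §2 `tr(w | M[k]) = χ_k(w) dim P^{g−k}(η)` -/

/-- **`tr(w | M[k]) = χ_k(w) · dim P^{g−k}(η)`**, `χ_k(w) = (−1)^{k/2}` for `k` even, `0` for `k` odd: the Fourier–Weyl element permutes the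
summands `Lⁱ P^{g−k} ↦ L^{k−i} P^{g−k}` ("`ℱ(θ^q z/q!) = ((−θ)^r/r!) z`"), fixing only the middle one. [cite: Beauville2010SL2, §5 Corollary and §4 Theorem]
[cite: BrockerTomDieck1985, II §5 (p0080, "χ_n … has the value Σ_{k=0}^{n} e^{i(n−2k)t} at e(t)")] [cite: Serre1977, §2.1 Exercise 2.2] -/
theorem trace_weylOperator_restrict_iSup_map_pow_lefschetzG_primitiveSpace (hη : ∀ v : E, v ≠ 0 → ∃ w : E, η ![v, w] ≠ 0) {k : ℕ}
    (hk : k ≤ finrank ℂ E) :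
    LinearMap.trace ℂ ↥(⨆ i : ℕ, (HasLefschetzProperty.primitiveSpace (countingG E) (lefschetzG η) k).map (lefschetzG η ^ i))
        (((hasLefschetzProperty_lefschetzG hη).weylOperator isZGrading_countingG).restrict
          ((hasLefschetzProperty_lefschetzG hη).weylOperator_mapsTo_iSup_map_pow_primitiveSpace isZGrading_countingG k)) =
      (if Even k then (-1 : ℂ) ^ (k / 2) else 0) * (finrank ℂ ↥(primitiveForms η (finrank ℂ E - k)) : ℂ) := by
  rw [(hasLefschetzProperty_lefschetzG hη).trace_weylOperator_restrict_iSup_map_pow_primitiveSpace isZGrading_countingG,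
    finrank_primitiveSpace_countingG hη hk]

/-- **`tr(w | M[2m]) = (−1)^m dim P^{g−2m}(η)`** (`2m ≤ g`). [cite: Beauville2010SL2, §5 Corollary] [cite: BrockerTomDieck1985, II §5 (p0080)] -/
theorem trace_weylOperator_restrict_iSup_map_pow_lefschetzG_primitiveSpace_two_mul (hη : ∀ v : E, v ≠ 0 → ∃ w : E, η ![v, w] ≠ 0) {m : ℕ}
    (hm : 2 * m ≤ finrank ℂ E) :
    LinearMap.trace ℂ ↥(⨆ i : ℕ, (HasLefschetzProperty.primitiveSpace (countingG E) (lefschetzG η) (2 * m)).map (lefschetzG η ^ i))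
        (((hasLefschetzProperty_lefschetzG hη).weylOperator isZGrading_countingG).restrict
          ((hasLefschetzProperty_lefschetzG hη).weylOperator_mapsTo_iSup_map_pow_primitiveSpace isZGrading_countingG (2 * m))) =
      (-1 : ℂ) ^ m * (finrank ℂ ↥(primitiveForms η (finrank ℂ E - 2 * m)) : ℂ) := by
  rw [(hasLefschetzProperty_lefschetzG hη).trace_weylOperator_restrict_isotypic_two_mul isZGrading_countingG,
    finrank_primitiveSpace_countingG hη hm]

/-- **`tr(w | M[2m+1]) = 0`** (every `m`). [cite: Beauville2010SL2, §5 Corollary] [cite: BrockerTomDieck1985, II §5 (p0080)] [cite: Serre1977, §2.1 Exercise 2.2] -/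
theorem trace_weylOperator_restrict_iSup_map_pow_lefschetzG_primitiveSpace_two_mul_add_one (hη : ∀ v : E, v ≠ 0 → ∃ w : E, η ![v, w] ≠ 0)
    (m : ℕ) :
    LinearMap.trace ℂ ↥(⨆ i : ℕ, (HasLefschetzProperty.primitiveSpace (countingG E) (lefschetzG η) (2 * m + 1)).map (lefschetzG η ^ i))
        (((hasLefschetzProperty_lefschetzG hη).weylOperator isZGrading_countingG).restrict
          ((hasLefschetzProperty_lefschetzG hη).weylOperator_mapsTo_iSup_map_pow_primitiveSpace isZGrading_countingG (2 * m + 1))) = 0 :=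
  (hasLefschetzProperty_lefschetzG hη).trace_weylOperator_restrict_isotypic_two_mul_add_one isZGrading_countingG m

/-! ## §3 `Σ_{m ≤ g/2} (−1)^m dim P^{g−2m}(η) = 2^g` -/

/-- **`Σ_{m ≤ g/2} (−1)^m dim_ℂ P^{g−2m}(η) = 2^g`**: the alternating sum of the primitive Betti numbers `dim Pᵍ − dim P^{g−2} + dim P^{g−4} − ⋯`
of a `g`-dimensional complex torus is `2^g` — both sides are the trace of the Fourier–Weyl element `w` on `H•(X; ℂ)` (`tr w = 2^g`, tree
`trace_weylOperator`; `tr w = Σ_m χ_{2m}(w) dim P^{g−2m}`, the odd string types contributing `0`). [cite: Beauville2010SL2, §3 Theorem and §4 Theorem]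
[cite: BrockerTomDieck1985, II §5 (p0080)] [cite: Lange2023AbelianVarietiesComplex, §7.3.2 (3)] -/
theorem sum_neg_one_pow_mul_finrank_primitiveForms_eq_two_pow (hη : ∀ v : E, v ≠ 0 → ∃ w : E, η ![v, w] ≠ 0) :
    ∑ m ∈ range (finrank ℂ E / 2 + 1), (-1 : ℤ) ^ m * (finrank ℂ ↥(primitiveForms η (finrank ℂ E - 2 * m)) : ℤ) = 2 ^ finrank ℂ E := by
  have hpos := finrank_pos (R := ℂ) (M := E)
  have h1 := (hasLefschetzProperty_lefschetzG hη).trace_weylOperator_eq_sum_neg_one_pow isZGrading_countingG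
  rw [trace_weylOperator hη, finrank_gForm] at h1
  -- only `m ≤ g/2` contributes
  have hsub : range (finrank ℂ E / 2 + 1) ⊆ range (2 ^ (2 * finrank ℂ E)) := range_subset_range.2 (by
    calc finrank ℂ E / 2 + 1 ≤ 2 * finrank ℂ E := by omega
      _ ≤ 2 ^ (2 * finrank ℂ E) := Nat.lt_two_pow_self.le)
  have h2 : ∑ m ∈ range (2 ^ (2 * finrank ℂ E)),
      (-1 : ℂ) ^ m * (finrank ℂ ↥(HasLefschetzProperty.primitiveSpace (countingG E) (lefschetzG η) (2 * m)) : ℂ) =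
      ∑ m ∈ range (finrank ℂ E / 2 + 1), (-1 : ℂ) ^ m * (finrank ℂ ↥(primitiveForms η (finrank ℂ E - 2 * m)) : ℂ) := by
    rw [← sum_subset hsub (fun m _ hm ↦ by
      rw [primitiveSpace_eq_bot_of_lt (by have := mem_range.not.1 hm; omega), finrank_bot, Nat.cast_zero, mul_zero])]
    exact sum_congr rfl fun m hm ↦ by rw [finrank_primitiveSpace_countingG hη (by have := mem_range.1 hm; omega)]
  rw [h2] at h1
  exact_mod_cast h1.symm

/-- **`Σ_{m ≤ g/2, m even} dim P^{g−2m}(η) = 2^g + Σ_{m ≤ g/2, m odd} dim P^{g−2m}(η)`** (the same count over `ℕ`: the string types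
`≡ g (mod 4)` outweigh the types `≡ g + 2 (mod 4)` by exactly `2^g`). [cite: Beauville2010SL2, §3 Theorem and §4 Theorem] [cite: BrockerTomDieck1985, II §5 (p0080)] -/
theorem sum_finrank_primitiveForms_even_eq_two_pow_add_sum_odd (hη : ∀ v : E, v ≠ 0 → ∃ w : E, η ![v, w] ≠ 0) :
    ∑ m ∈ (range (finrank ℂ E / 2 + 1)).filter Even, finrank ℂ ↥(primitiveForms η (finrank ℂ E - 2 * m)) =
      2 ^ finrank ℂ E + ∑ m ∈ (range (finrank ℂ E / 2 + 1)).filter Odd, finrank ℂ ↥(primitiveForms η (finrank ℂ E - 2 * m)) := by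
  have h1 := sum_neg_one_pow_mul_finrank_primitiveForms_eq_two_pow hη
  rw [← sum_filter_add_sum_filter_not (range (finrank ℂ E / 2 + 1)) Even] at h1
  have h2 : ∑ m ∈ (range (finrank ℂ E / 2 + 1)).filter Even, (-1 : ℤ) ^ m * (finrank ℂ ↥(primitiveForms η (finrank ℂ E - 2 * m)) : ℤ) =
      ∑ m ∈ (range (finrank ℂ E / 2 + 1)).filter Even, (finrank ℂ ↥(primitiveForms η (finrank ℂ E - 2 * m)) : ℤ) :=
    sum_congr rfl fun m hm ↦ by rw [(mem_filter.1 hm).2.neg_one_pow, one_mul]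
  have h3 : ∑ m ∈ (range (finrank ℂ E / 2 + 1)).filter (fun m ↦ ¬Even m),
      (-1 : ℤ) ^ m * (finrank ℂ ↥(primitiveForms η (finrank ℂ E - 2 * m)) : ℤ) =
      -∑ m ∈ (range (finrank ℂ E / 2 + 1)).filter Odd, (finrank ℂ ↥(primitiveForms η (finrank ℂ E - 2 * m)) : ℤ) := by
    rw [← sum_neg_distrib]
    refine sum_congr (filter_congr fun m _ ↦ Nat.not_even_iff_odd) fun m hm ↦ ?_
    rw [(mem_filter.1 hm).2.neg_one_pow, neg_one_mul]
  rw [h2, h3] at h1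
  have h4 : (∑ m ∈ (range (finrank ℂ E / 2 + 1)).filter Even, (finrank ℂ ↥(primitiveForms η (finrank ℂ E - 2 * m)) : ℤ)) =
      2 ^ finrank ℂ E + ∑ m ∈ (range (finrank ℂ E / 2 + 1)).filter Odd, (finrank ℂ ↥(primitiveForms η (finrank ℂ E - 2 * m)) : ℤ) := by
    linear_combination h1
  exact_mod_cast h4

/-! ## §4 The multiplicities of `1`, `−1`, `±i` on each isotypic piece -/

/-- **`2 dim (M[2m] ∩ ker(w − 1)) = (2m + 1 + (−1)^m) dim P^{g−2m}(η)`** (`2m ≤ g`): each string `V(2m)` through a primitive class of degree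
`g − 2m` carries `m + 1` (resp. `m`) classes fixed by the Fourier–Weyl element for `m` even (resp. odd).
[cite: Serre1977, §2.6 Thm. 8 (ii) and Exercise 2.8 (a)] [cite: BrockerTomDieck1985, II §5 (p0080)] [cite: Beauville2010SL2, §4 Theorem and §5 Corollary] -/
theorem two_mul_finrank_iSup_map_pow_lefschetzG_primitiveSpace_two_mul_inf_eigenspace_weylOperator_one
    (hη : ∀ v : E, v ≠ 0 → ∃ w : E, η ![v, w] ≠ 0) {m : ℕ} (hm : 2 * m ≤ finrank ℂ E) :
    (2 : ℂ) * (finrank ℂ ↥((⨆ i : ℕ, (HasLefschetzProperty.primitiveSpace (countingG E) (lefschetzG η) (2 * m)).map (lefschetzG η ^ i)) ⊓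
        Module.End.eigenspace ((hasLefschetzProperty_lefschetzG hη).weylOperator isZGrading_countingG) 1) : ℂ) =
      ((2 * m + 1 : ℂ) + (-1) ^ m) * (finrank ℂ ↥(primitiveForms η (finrank ℂ E - 2 * m)) : ℂ) := by
  rw [(hasLefschetzProperty_lefschetzG hη).two_mul_finrank_isotypic_two_mul_inf_eigenspace_weylOperator_one isZGrading_countingG,
    finrank_primitiveSpace_countingG hη hm]

/-- **`2 dim (M[2m] ∩ ker(w + 1)) = (2m + 1 − (−1)^m) dim P^{g−2m}(η)`** (`2m ≤ g`). [cite: Serre1977, §2.6 Thm. 8 (ii) and Exercise 2.8 (a)]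
[cite: BrockerTomDieck1985, II §5 (p0080)] [cite: Beauville2010SL2, §4 Theorem and §5 Corollary] -/
theorem two_mul_finrank_iSup_map_pow_lefschetzG_primitiveSpace_two_mul_inf_eigenspace_weylOperator_neg_one
    (hη : ∀ v : E, v ≠ 0 → ∃ w : E, η ![v, w] ≠ 0) {m : ℕ} (hm : 2 * m ≤ finrank ℂ E) :
    (2 : ℂ) * (finrank ℂ ↥((⨆ i : ℕ, (HasLefschetzProperty.primitiveSpace (countingG E) (lefschetzG η) (2 * m)).map (lefschetzG η ^ i)) ⊓
        Module.End.eigenspace ((hasLefschetzProperty_lefschetzG hη).weylOperator isZGrading_countingG) (-1)) : ℂ) =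
      ((2 * m + 1 : ℂ) - (-1) ^ m) * (finrank ℂ ↥(primitiveForms η (finrank ℂ E - 2 * m)) : ℂ) := by
  rw [(hasLefschetzProperty_lefschetzG hη).two_mul_finrank_isotypic_two_mul_inf_eigenspace_weylOperator_neg_one isZGrading_countingG,
    finrank_primitiveSpace_countingG hη hm]

/-- **No `i`-eigenvector of `w` in an even piece `M[2m]`** (`w² = +1` there). [cite: Beauville2010SL2, §3 Proposition (ii)] [cite: Serre1977, §2.6 Thm. 8 (i)] -/
theorem iSup_map_pow_lefschetzG_primitiveSpace_two_mul_inf_eigenspace_weylOperator_I (hη : ∀ v : E, v ≠ 0 → ∃ w : E, η ![v, w] ≠ 0) (m : ℕ) :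
    (⨆ i : ℕ, (HasLefschetzProperty.primitiveSpace (countingG E) (lefschetzG η) (2 * m)).map (lefschetzG η ^ i)) ⊓
        Module.End.eigenspace ((hasLefschetzProperty_lefschetzG hη).weylOperator isZGrading_countingG) I = ⊥ :=
  (hasLefschetzProperty_lefschetzG hη).isotypic_two_mul_inf_eigenspace_weylOperator_eq_bot isZGrading_countingG m I_sq

/-- **No `−i`-eigenvector of `w` in an even piece `M[2m]`.** [cite: Beauville2010SL2, §3 Proposition (ii)] [cite: Serre1977, §2.6 Thm. 8 (i)] -/
theorem iSup_map_pow_lefschetzG_primitiveSpace_two_mul_inf_eigenspace_weylOperator_neg_I (hη : ∀ v : E, v ≠ 0 → ∃ w : E, η ![v, w] ≠ 0)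
    (m : ℕ) :
    (⨆ i : ℕ, (HasLefschetzProperty.primitiveSpace (countingG E) (lefschetzG η) (2 * m)).map (lefschetzG η ^ i)) ⊓
        Module.End.eigenspace ((hasLefschetzProperty_lefschetzG hη).weylOperator isZGrading_countingG) (-I) = ⊥ :=
  (hasLefschetzProperty_lefschetzG hη).isotypic_two_mul_inf_eigenspace_weylOperator_eq_bot isZGrading_countingG m (by rw [neg_sq, I_sq])

/-- **No class of an odd piece `M[2m+1]` is fixed by `w`** (`w² = −1` there). [cite: Beauville2010SL2, §3 Proposition (ii)] [cite: Serre1977, §2.6 Thm. 8 (i)] -/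
theorem iSup_map_pow_lefschetzG_primitiveSpace_two_mul_add_one_inf_eigenspace_weylOperator_one
    (hη : ∀ v : E, v ≠ 0 → ∃ w : E, η ![v, w] ≠ 0) (m : ℕ) :
    (⨆ i : ℕ, (HasLefschetzProperty.primitiveSpace (countingG E) (lefschetzG η) (2 * m + 1)).map (lefschetzG η ^ i)) ⊓
        Module.End.eigenspace ((hasLefschetzProperty_lefschetzG hη).weylOperator isZGrading_countingG) 1 = ⊥ :=
  (hasLefschetzProperty_lefschetzG hη).isotypic_two_mul_add_one_inf_eigenspace_weylOperator_eq_bot isZGrading_countingG m (one_pow 2)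

/-- **No `−1`-eigenvector of `w` in an odd piece `M[2m+1]`.** [cite: Beauville2010SL2, §3 Proposition (ii)] [cite: Serre1977, §2.6 Thm. 8 (i)] -/
theorem iSup_map_pow_lefschetzG_primitiveSpace_two_mul_add_one_inf_eigenspace_weylOperator_neg_one
    (hη : ∀ v : E, v ≠ 0 → ∃ w : E, η ![v, w] ≠ 0) (m : ℕ) :
    (⨆ i : ℕ, (HasLefschetzProperty.primitiveSpace (countingG E) (lefschetzG η) (2 * m + 1)).map (lefschetzG η ^ i)) ⊓
        Module.End.eigenspace ((hasLefschetzProperty_lefschetzG hη).weylOperator isZGrading_countingG) (-1) = ⊥ :=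
  (hasLefschetzProperty_lefschetzG hη).isotypic_two_mul_add_one_inf_eigenspace_weylOperator_eq_bot isZGrading_countingG m (by rw [neg_one_sq])

/-- **`dim (M[2m+1] ∩ ker(w − i)) = (m + 1) dim P^{g−2m−1}(η)`** (`2m + 1 ≤ g`): each string `V(2m+1)` through a primitive class of degree
`g − 2m − 1` carries `m + 1` eigenclasses of the Fourier–Weyl element for `i` (and `m + 1` for `−i`).
[cite: Serre1977, §2.6 Thm. 8 (ii) and Exercise 2.8 (a), §5.1] [cite: BrockerTomDieck1985, II §5 (p0080)] [cite: Beauville2010SL2, §4 Theorem and §5 Corollary] -/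
theorem finrank_iSup_map_pow_lefschetzG_primitiveSpace_two_mul_add_one_inf_eigenspace_weylOperator_I
    (hη : ∀ v : E, v ≠ 0 → ∃ w : E, η ![v, w] ≠ 0) {m : ℕ} (hm : 2 * m + 1 ≤ finrank ℂ E) :
    finrank ℂ ↥((⨆ i : ℕ, (HasLefschetzProperty.primitiveSpace (countingG E) (lefschetzG η) (2 * m + 1)).map (lefschetzG η ^ i)) ⊓
        Module.End.eigenspace ((hasLefschetzProperty_lefschetzG hη).weylOperator isZGrading_countingG) I) =
      (m + 1) * finrank ℂ ↥(primitiveForms η (finrank ℂ E - (2 * m + 1))) := by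
  have h1 := (hasLefschetzProperty_lefschetzG hη).finrank_isotypic_two_mul_add_one_inf_eigenspace_weylOperator isZGrading_countingG m I_sq
  rw [finrank_primitiveSpace_countingG hη hm] at h1
  exact_mod_cast h1

/-- **`dim (M[2m+1] ∩ ker(w + i)) = (m + 1) dim P^{g−2m−1}(η)`** (`2m + 1 ≤ g`). [cite: Serre1977, §2.6 Thm. 8 (ii) and Exercise 2.8 (a), §5.1]
[cite: BrockerTomDieck1985, II §5 (p0080)] [cite: Beauville2010SL2, §4 Theorem and §5 Corollary] -/
theorem finrank_iSup_map_pow_lefschetzG_primitiveSpace_two_mul_add_one_inf_eigenspace_weylOperator_neg_I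
    (hη : ∀ v : E, v ≠ 0 → ∃ w : E, η ![v, w] ≠ 0) {m : ℕ} (hm : 2 * m + 1 ≤ finrank ℂ E) :
    finrank ℂ ↥((⨆ i : ℕ, (HasLefschetzProperty.primitiveSpace (countingG E) (lefschetzG η) (2 * m + 1)).map (lefschetzG η ^ i)) ⊓
        Module.End.eigenspace ((hasLefschetzProperty_lefschetzG hη).weylOperator isZGrading_countingG) (-I)) =
      (m + 1) * finrank ℂ ↥(primitiveForms η (finrank ℂ E - (2 * m + 1))) := by
  have h1 := (hasLefschetzProperty_lefschetzG hη).finrank_isotypic_two_mul_add_one_inf_eigenspace_weylOperator isZGrading_countingG m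
    (μ := -I) (by rw [neg_sq, I_sq])
  rw [finrank_primitiveSpace_countingG hη hm] at h1
  exact_mod_cast h1


/-! ## §5 All the pieces: `H•(X; ℂ) = ⊕_{k ≤ g} M[k]`, and the multiplicities of `w` summed over the string types -/

/-- **`H•(X; ℂ) = ⊕_{k ≤ g} M[k]`**: the isotypic pieces of types `0, …, g` exhaust the cohomology (the types `> g` do not occur).
[cite: Lange2023AbelianVarietiesComplex, §7.3.2 (3)] [cite: LooijengaLunts1997, §1 (1.14) p. 7 ("M ≅ ⊕_k V(k) ⊗ P_{−k}")] -/
theorem biSup_iSup_map_pow_lefschetzG_primitiveSpace_eq_top (hη : ∀ v : E, v ≠ 0 → ∃ w : E, η ![v, w] ≠ 0) :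
    ⨆ k ∈ range (finrank ℂ E + 1), ⨆ i : ℕ, (HasLefschetzProperty.primitiveSpace (countingG E) (lefschetzG η) k).map (lefschetzG η ^ i) = ⊤ := by
  rw [← (hasLefschetzProperty_lefschetzG hη).iSup_iSup_map_pow_primitiveSpace_eq_top isZGrading_countingG]
  refine le_antisymm (iSup₂_le fun k _ ↦ le_iSup (fun k : ℕ ↦ ⨆ i : ℕ,
    (HasLefschetzProperty.primitiveSpace (countingG E) (lefschetzG η) k).map (lefschetzG η ^ i)) k) (iSup_le fun k ↦ ?_)
  by_cases hk : k ≤ finrank ℂ E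
  · exact le_iSup₂_of_le (f := fun (k : ℕ) (_ : k ∈ range (finrank ℂ E + 1)) ↦ ⨆ i : ℕ,
      (HasLefschetzProperty.primitiveSpace (countingG E) (lefschetzG η) k).map (lefschetzG η ^ i)) k (mem_range.2 (Nat.lt_succ_of_le hk)) le_rfl
  · rw [iSup_map_pow_lefschetzG_primitiveSpace_eq_bot (not_le.1 hk)]
    exact bot_le

/-- **`dim ker(w − i) = Σ_{k ≤ g, k odd} ((k + 1)/2) · dim P^{g−k}(η)`** — the `i`-eigenclasses of the Fourier–Weyl element come from the odd
string types only, `(k + 1)/2` per string. [cite: Serre1977, §2.6 Thm. 8 (ii) and Exercise 2.8 (a), §5.1] [cite: BrockerTomDieck1985, II §5 (p0080)]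
[cite: Beauville2010SL2, §4 Theorem and §5 Corollary] -/
theorem finrank_eigenspace_weylOperator_I_eq_sum_primitiveForms (hη : ∀ v : E, v ≠ 0 → ∃ w : E, η ![v, w] ≠ 0) :
    (finrank ℂ ↥(Module.End.eigenspace ((hasLefschetzProperty_lefschetzG hη).weylOperator isZGrading_countingG) I) : ℂ) =
      ∑ k ∈ (range (finrank ℂ E + 1)).filter Odd, (((k + 1) / 2 : ℕ) : ℂ) * (finrank ℂ ↥(primitiveForms η (finrank ℂ E - k)) : ℂ) := by
  have h1 := (hasLefschetzProperty_lefschetzG hη).finrank_biSup_iSup_map_pow_primitiveSpace_inf_eigenspace_weylOperator_of_sq_eq_neg_one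
    isZGrading_countingG (range (finrank ℂ E + 1)) I_sq
  rw [biSup_iSup_map_pow_lefschetzG_primitiveSpace_eq_top hη, top_inf_eq] at h1
  rw [h1]
  exact sum_congr rfl fun k hk ↦ by
    rw [finrank_primitiveSpace_countingG hη (by have := mem_range.1 (mem_filter.1 hk).1; omega)]

/-- **`Σ_{k ≤ g, k odd} ((k + 1)/2) · dim_ℂ P^{g−k}(η) = 4^{g−1}`** (both sides count the `i`-eigenclasses of `w`: `dim ker(w − i) = 4^{g−1}`,
tree `finrank_eigenspace_weylOperator_I`). [cite: Serre1977, §2.6 Thm. 8 (ii) and Exercise 2.8 (a)] [cite: Beauville2010SL2, §3 Theorem and §4 Theorem]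
[cite: Lange2023AbelianVarietiesComplex, §7.3.2 (3)] -/
theorem sum_odd_mul_finrank_primitiveForms_eq_pow (hη : ∀ v : E, v ≠ 0 → ∃ w : E, η ![v, w] ≠ 0) :
    ∑ k ∈ (range (finrank ℂ E + 1)).filter Odd, (k + 1) / 2 * finrank ℂ ↥(primitiveForms η (finrank ℂ E - k)) = 4 ^ (finrank ℂ E - 1) := by
  have h1 := finrank_eigenspace_weylOperator_I_eq_sum_primitiveForms hη
  rw [finrank_eigenspace_weylOperator_I hη] at h1
  exact_mod_cast h1.symm

/-- **`2 dim ker(w − 1) = Σ_{k ≤ g, k even} (k + 1 + (−1)^{k/2}) · dim P^{g−k}(η)`.** [cite: Serre1977, §2.6 Thm. 8 (ii) and Exercise 2.8 (a)]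
[cite: BrockerTomDieck1985, II §5 (p0080)] [cite: Beauville2010SL2, §4 Theorem and §5 Corollary] -/
theorem two_mul_finrank_eigenspace_weylOperator_one_eq_sum_primitiveForms (hη : ∀ v : E, v ≠ 0 → ∃ w : E, η ![v, w] ≠ 0) :
    (2 : ℂ) * (finrank ℂ ↥(Module.End.eigenspace ((hasLefschetzProperty_lefschetzG hη).weylOperator isZGrading_countingG) 1) : ℂ) =
      ∑ k ∈ (range (finrank ℂ E + 1)).filter Even, ((k : ℂ) + 1 + (-1) ^ (k / 2)) * (finrank ℂ ↥(primitiveForms η (finrank ℂ E - k)) : ℂ) := by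
  have h1 := (hasLefschetzProperty_lefschetzG hη).two_mul_finrank_biSup_iSup_map_pow_primitiveSpace_inf_eigenspace_weylOperator_one
    isZGrading_countingG (range (finrank ℂ E + 1))
  rw [biSup_iSup_map_pow_lefschetzG_primitiveSpace_eq_top hη, top_inf_eq] at h1
  rw [h1]
  exact sum_congr rfl fun k hk ↦ by
    rw [finrank_primitiveSpace_countingG hη (by have := mem_range.1 (mem_filter.1 hk).1; omega)]

/-- **`Σ_{k ≤ g, k even} (k + 1 + (−1)^{k/2}) · dim_ℂ P^{g−k}(η) = 2 (4^{g−1} + 2^{g−1})`** (`= 2 dim ker(w − 1)`, tree `finrank_eigenspace_weylOperator_one`).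
[cite: Serre1977, §2.6 Thm. 8 (ii) and Exercise 2.8 (a)] [cite: Beauville2010SL2, §3 Theorem and §4 Theorem] [cite: Lange2023AbelianVarietiesComplex, §7.3.2 (3)] -/
theorem sum_even_mul_finrank_primitiveForms_eq (hη : ∀ v : E, v ≠ 0 → ∃ w : E, η ![v, w] ≠ 0) :
    ∑ k ∈ (range (finrank ℂ E + 1)).filter Even, ((k : ℤ) + 1 + (-1) ^ (k / 2)) * (finrank ℂ ↥(primitiveForms η (finrank ℂ E - k)) : ℤ) =
      2 * (4 ^ (finrank ℂ E - 1) + 2 ^ (finrank ℂ E - 1)) := by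
  have h1 := two_mul_finrank_eigenspace_weylOperator_one_eq_sum_primitiveForms hη
  rw [finrank_eigenspace_weylOperator_one hη] at h1
  exact_mod_cast h1.symm

/-- **`2 dim ker(w + 1) = Σ_{k ≤ g, k even} (k + 1 − (−1)^{k/2}) · dim P^{g−k}(η)`.** [cite: Serre1977, §2.6 Thm. 8 (ii) and Exercise 2.8 (a)]
[cite: BrockerTomDieck1985, II §5 (p0080)] [cite: Beauville2010SL2, §4 Theorem and §5 Corollary] -/
theorem two_mul_finrank_eigenspace_weylOperator_neg_one_eq_sum_primitiveForms (hη : ∀ v : E, v ≠ 0 → ∃ w : E, η ![v, w] ≠ 0) :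
    (2 : ℂ) * (finrank ℂ ↥(Module.End.eigenspace ((hasLefschetzProperty_lefschetzG hη).weylOperator isZGrading_countingG) (-1)) : ℂ) =
      ∑ k ∈ (range (finrank ℂ E + 1)).filter Even, ((k : ℂ) + 1 - (-1) ^ (k / 2)) * (finrank ℂ ↥(primitiveForms η (finrank ℂ E - k)) : ℂ) := by
  have h1 := (hasLefschetzProperty_lefschetzG hη).two_mul_finrank_biSup_iSup_map_pow_primitiveSpace_inf_eigenspace_weylOperator_neg_one
    isZGrading_countingG (range (finrank ℂ E + 1))
  rw [biSup_iSup_map_pow_lefschetzG_primitiveSpace_eq_top hη, top_inf_eq] at h1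
  rw [h1]
  exact sum_congr rfl fun k hk ↦ by
    rw [finrank_primitiveSpace_countingG hη (by have := mem_range.1 (mem_filter.1 hk).1; omega)]

/-- **`Σ_{k ≤ g, k even} (k + 1 − (−1)^{k/2}) · dim_ℂ P^{g−k}(η) = 2 (4^{g−1} − 2^{g−1})`** (`= 2 dim ker(w + 1)`, tree `finrank_eigenspace_weylOperator_neg_one`).
[cite: Serre1977, §2.6 Thm. 8 (ii) and Exercise 2.8 (a)] [cite: Beauville2010SL2, §3 Theorem and §4 Theorem] [cite: Lange2023AbelianVarietiesComplex, §7.3.2 (3)] -/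
theorem sum_even_mul_finrank_primitiveForms_eq' (hη : ∀ v : E, v ≠ 0 → ∃ w : E, η ![v, w] ≠ 0) :
    ∑ k ∈ (range (finrank ℂ E + 1)).filter Even, ((k : ℤ) + 1 - (-1) ^ (k / 2)) * (finrank ℂ ↥(primitiveForms η (finrank ℂ E - k)) : ℤ) =
      2 * ((4 ^ (finrank ℂ E - 1) - 2 ^ (finrank ℂ E - 1) : ℕ) : ℤ) := by
  have h1 := two_mul_finrank_eigenspace_weylOperator_neg_one_eq_sum_primitiveForms hη
  rw [finrank_eigenspace_weylOperator_neg_one hη] at h1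
  exact_mod_cast h1.symm

end ComplexTorus

end Literature.Geometry.Kaehler
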